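import Summits.CriticalPhenomena.Ising3DConformalLimit.Theses.CoerciveSharpness
import Summits.CriticalPhenomena.Ising3DConformalLimit.Theses.ClusterRigidity
import Summits.CriticalPhenomena.Ising3DConformalLimit.Theses.HelsonAxis
import Summits.CriticalPhenomena.Ising3DConformalLimit.Theorems.CoerciveSharpnessDimensionPinnedStubLambdaRate
import Summits.CriticalPhenomena.Ising3DConformalLimit.Theorems.CoerciveSharpnessDimensionPinnedStubDock
import Summits.CriticalPhenomena.Ising3DConformalLimit.Theorems.CoerciveSharpnessDimensionPinnedStubBlockVarianceBounds
import Summits.CriticalPhenomena.Ising3DConformalLimit.Theorems.CoerciveSharpnessDimensionPinnedStubOctaveTelescoping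
import Summits.CriticalPhenomena.Ising3DConformalLimit.Theorems.CoerciveSharpnessDimensionPinnedStubLowerEnvelope
import Literature.Probability.LatticeModels.PointwiseScalingLimitEtaExists
import HarnessLib

/-!
# Route `CoerciveSharpness`, crux `DimensionPinned` (item stmt-CriticalPhenomena-4662), line `Sketch`:
# the transfer `DCR₂₇ → DimensionPinned` (registered stub `stub_transfer`)

`DimensionPinned := ∃ η, HasIsingEtaBounds 3 η` (two-sided pure-power bounds for `⟨σ₀σ_x⟩_{β_c(3)}`;
shared item of the routes ClusterRigidity / CoerciveSharpness / HelsonAxis).  This file composes the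
landed stubs of the line `Cruxes/DimensionPinned/Lines/Sketch.lean` (idea `octave-telescoping-block-dock`):
`stub_lambdaRate` (DCR₂₇ ⟹ power rate of the octave ratio of block variances, ratio `≥ 8`),
`stub_blockVarianceBounds` (`c L⁴ ≤ V_L ≤ L⁶`, `L⁶ g(3L) ≤ V_L`), `stub_octaveTelescoping`
(Li–Shiraishi telescoping) and `stub_lowerEnvelope` (shell peeling), with the glue proved here
(`Λ ∈ [16,64]`, `s := 6 - log₂ Λ ∈ [0,2]`, dyadic fill-in of the upper envelope, MMS sphere sandwich
axis ⟹ all directions), into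

* `stub_transfer : DCR₂₇ → CoerciveSharpness.DimensionPinned` — the crux is a COROLLARY of the
  power-rate Cauchy property of the 27 nearest normalised block covariances under `L ↦ 2L`;
* `clusterRigidity_dimensionPinned_of_dcr`, `helsonAxis_etaBoundsExist_of_dcr` — the same for the
  two other route decls of the shared item (identical terms).

DCR₂₇ itself (`stub_dilationCovarianceRate`) is the open input of the line; `stub_dock` (landed) derives it from
item stmt-CriticalPhenomena-18762 (`SynchronousCoupling.DilationJoinings`), whence
`dimensionPinned_of_dilationJoinings : DilationJoinings → DimensionPinned` below: the crux is a corollary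
of item 18762.  No definition, no notation.
-/

noncomputable section

namespace Summit.CriticalPhenomena.Ising3DConformalLimit.Theorems.CoerciveSharpnessDimensionPinned

open scoped BigOperators
open Filter Topology Finset
open Literature.Probability.LatticeModels
open Summit.CriticalPhenomena.Ising3DConformalLimit.Theses.CoerciveSharpness (DimensionPinned)
open Summit.CriticalPhenomena.Ising3DConformalLimit.Theses.SynchronousCoupling (DilationJoinings)


namespace Glue

/-- If `a x^k ≤ B y^k` for all `k` with `a, x, y > 0`, then `x ≤ y`. [folklore] -/
theorem le_of_forall_mul_pow_le {a B x y : ℝ} (ha : 0 < a) (hy : 0 < y)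
    (h : ∀ k : ℕ, a * x ^ k ≤ B * y ^ k) : x ≤ y := by
  by_contra hlt
  push Not at hlt
  have hr : 1 < x / y := (one_lt_div hy).2 hlt
  have ht : Tendsto (fun k : ℕ => a * (x / y) ^ k) atTop atTop :=
    Tendsto.const_mul_atTop ha (tendsto_pow_atTop_atTop_of_one_lt hr)
  obtain ⟨k, hk⟩ := (ht.eventually_gt_atTop B).exists
  have hyk : 0 < y ^ k := pow_pos hy k
  have hk' : a * (x / y) ^ k ≤ B := by
    rw [div_pow, ← mul_div_assoc, div_le_iff₀ hyk]
    exact h k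
  linarith

/-- `Λ^k = (2^k)^{log₂ Λ}` for `Λ > 0`. [folklore] -/
theorem pow_eq_two_pow_rpow_logb {Λ : ℝ} (hΛ : 0 < Λ) (k : ℕ) :
    Λ ^ k = ((2:ℝ) ^ k) ^ (Real.logb 2 Λ) := by
  rw [← Real.rpow_natCast (2:ℝ) k, ← Real.rpow_mul (by norm_num : (0:ℝ) ≤ 2), mul_comm,
    Real.rpow_mul (by norm_num : (0:ℝ) ≤ 2), Real.rpow_logb two_pos (by norm_num) hΛ,
    Real.rpow_natCast]

/-- `log₂ (2^n) = n`. [folklore] -/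
theorem logb_two_pow (n : ℕ) : Real.logb 2 ((2:ℝ) ^ n) = n := by
  rw [Real.logb_pow, Real.logb_self_eq_one one_lt_two, mul_one]

/-- **Dyadic fill-in of an upper envelope.** A positive antitone `g ≤ 1` with
`g(3·2^k) ≤ B (2^k)^{-s}` (`s ≥ 0`) satisfies `g n ≤ C n^{-s}` for `n ≥ 1`. [folklore] -/
theorem upper_fill {g : ℕ → ℝ} (hpos : ∀ n, 0 < g n) (hanti : Antitone g) (hle1 : ∀ n, g n ≤ 1)
    {s B : ℝ} (hs : 0 ≤ s) (h : ∀ k : ℕ, g (3 * 2 ^ k) ≤ B * ((2:ℝ) ^ k) ^ (-s)) :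
    ∃ C : ℝ, ∀ n : ℕ, 1 ≤ n → g n ≤ C * (n : ℝ) ^ (-s) := by
  have hB : 0 ≤ B := by
    have h0 := (hpos (3 * 2 ^ 0)).trans_le (h 0)
    simp at h0
    exact h0.le
  refine ⟨max (B * (6:ℝ) ^ s) ((2:ℝ) ^ s), fun n hn => ?_⟩
  have hnpos : (0:ℝ) < n := by exact_mod_cast (show 0 < n by omega)
  have hns : 0 ≤ (n:ℝ) ^ (-s) := Real.rpow_nonneg hnpos.le _
  rcases lt_or_ge n 3 with hn3 | hn3
  · -- n ∈ {1, 2}: g n ≤ 1 ≤ 2^s n^{-s}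
    have h2 : (1:ℝ) ≤ (2:ℝ) ^ s * (n:ℝ) ^ (-s) := by
      have hle : (n:ℝ) ≤ 2 := by exact_mod_cast (show n ≤ 2 by omega)
      have h1 : (2:ℝ) ^ (-s) ≤ (n:ℝ) ^ (-s) :=
        Real.rpow_le_rpow_of_nonpos hnpos hle (neg_nonpos.2 hs)
      have h22 : (2:ℝ) ^ s * (2:ℝ) ^ (-s) = 1 := by
        rw [← Real.rpow_add two_pos, add_neg_cancel, Real.rpow_zero]
      calc (1:ℝ) = (2:ℝ) ^ s * (2:ℝ) ^ (-s) := h22.symm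
        _ ≤ (2:ℝ) ^ s * (n:ℝ) ^ (-s) := mul_le_mul_of_nonneg_left h1 (by positivity)
    calc g n ≤ 1 := hle1 n
      _ ≤ (2:ℝ) ^ s * (n:ℝ) ^ (-s) := h2
      _ ≤ max (B * (6:ℝ) ^ s) ((2:ℝ) ^ s) * (n:ℝ) ^ (-s) :=
          mul_le_mul_of_nonneg_right (le_max_right _ _) hns
  · set k := Nat.log 2 (n / 3) with hk
    have hq : n / 3 ≠ 0 := by omega
    have h1 : 2 ^ k ≤ n / 3 := Nat.pow_log_le_self 2 hq
    have h2 : n / 3 < 2 ^ (k + 1) := Nat.lt_pow_succ_log_self (by norm_num) _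
    have h3 : 3 * 2 ^ k ≤ n := by omega
    have h4 : n < 6 * 2 ^ k := by
      have : 2 ^ (k + 1) = 2 * 2 ^ k := by ring
      omega
    have h2k : (0:ℝ) < (2:ℝ) ^ k := by positivity
    have hle : (n:ℝ) ≤ 6 * (2:ℝ) ^ k := by exact_mod_cast h4.le
    have hcmp : ((6:ℝ) * (2:ℝ) ^ k) ^ (-s) ≤ (n:ℝ) ^ (-s) :=
      Real.rpow_le_rpow_of_nonpos hnpos hle (neg_nonpos.2 hs)
    have hsplit : ((6:ℝ) * (2:ℝ) ^ k) ^ (-s) = (6:ℝ) ^ (-s) * ((2:ℝ) ^ k) ^ (-s) :=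
      Real.mul_rpow (by norm_num) h2k.le
    have h66 : (6:ℝ) ^ s * (6:ℝ) ^ (-s) = 1 := by
      rw [← Real.rpow_add (by norm_num : (0:ℝ) < 6), add_neg_cancel, Real.rpow_zero]
    calc g n ≤ g (3 * 2 ^ k) := hanti h3
      _ ≤ B * ((2:ℝ) ^ k) ^ (-s) := h k
      _ = B * (6:ℝ) ^ s * ((6:ℝ) * (2:ℝ) ^ k) ^ (-s) := by
          rw [hsplit, show B * (6:ℝ) ^ s * ((6:ℝ) ^ (-s) * ((2:ℝ) ^ k) ^ (-s)) =
            B * ((6:ℝ) ^ s * (6:ℝ) ^ (-s)) * ((2:ℝ) ^ k) ^ (-s) by ring, h66, mul_one]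
      _ ≤ B * (6:ℝ) ^ s * (n:ℝ) ^ (-s) := mul_le_mul_of_nonneg_left hcmp (by positivity)
      _ ≤ max (B * (6:ℝ) ^ s) ((2:ℝ) ^ s) * (n:ℝ) ^ (-s) :=
          mul_le_mul_of_nonneg_right (le_max_left _ _) hns

/-- **The analytic core of the line, abstractly.** For a positive sequence `v` (block variances along
`2^k`) with octave ratios `≥ 8`, a power rate on consecutive octave ratios, a priori
`c 16^k ≤ v k ≤ 64^k`, and a positive antitone `g ≤ 1` with `(2^k)^6 g(3·2^k) ≤ v k`, the telescoping
statement and the lower-envelope statement yield two-sided power bounds for `g`. [folklore] -/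
theorem axis_bounds_core (v g : ℕ → ℝ) {θ C c : ℝ} (hθ : 0 < θ) (hc : 0 < c)
    (hv8 : ∀ k : ℕ, 8 ≤ v (k + 1) / v k)
    (hvrate : ∀ k : ℕ, |v (k + 2) / v (k + 1) - v (k + 1) / v k| ≤ C * ((2:ℝ) ^ k) ^ (-θ))
    (hvlo : ∀ k : ℕ, c * ((2:ℝ) ^ k) ^ 4 ≤ v k) (hvhi : ∀ k : ℕ, v k ≤ ((2:ℝ) ^ k) ^ 6)
    (hvg : ∀ k : ℕ, ((2:ℝ) ^ k) ^ 6 * g (3 * 2 ^ k) ≤ v k)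
    (hgpos : ∀ n, 0 < g n) (hganti : Antitone g) (hgle1 : ∀ n, g n ≤ 1)
    (h4 : ∀ (v : ℕ → ℝ) (m θ C : ℝ), 0 < m → 0 < θ →
      (∀ k : ℕ, 0 < v k) → (∀ k : ℕ, m ≤ v (k + 1) / v k) →
      (∀ k : ℕ, |v (k + 2) / v (k + 1) - v (k + 1) / v k| ≤ C * ((2:ℝ) ^ k) ^ (-θ)) →
      ∃ Λ A₁ A₂ : ℝ, m ≤ Λ ∧ 0 < A₁ ∧ ∀ k : ℕ, A₁ * Λ ^ k ≤ v k ∧ v k ≤ A₂ * Λ ^ k)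
    (h5 : ∀ (s A B : ℝ), 0 ≤ s → s ≤ 2 → 0 < A →
      (∀ k : ℕ, A * ((2:ℝ) ^ k) ^ ((6:ℝ) - s) ≤ v k) →
      (∀ n : ℕ, 1 ≤ n → g n ≤ B * (n : ℝ) ^ (-s)) →
      ∃ c : ℝ, 0 < c ∧ ∀ n : ℕ, 1 ≤ n → c * (n : ℝ) ^ (-s) ≤ g n) :
    ∃ s c' C' : ℝ, 0 < c' ∧ ∀ n : ℕ, 1 ≤ n → c' * (n : ℝ) ^ (-s) ≤ g n ∧ g n ≤ C' * (n : ℝ) ^ (-s) := by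
  have hvpos : ∀ k, 0 < v k := fun k => lt_of_lt_of_le (by positivity) (hvlo k)
  obtain ⟨Λ, A₁, A₂, hΛ8, hA₁, hΛ⟩ := h4 v 8 θ C (by norm_num) hθ hvpos hv8 hvrate
  have hΛpos : 0 < Λ := by linarith
  -- `Λ ∈ [16, 64]` from the a priori window
  have h16 : (16:ℝ) ≤ Λ := by
    refine le_of_forall_mul_pow_le hc hΛpos (B := A₂) fun k => ?_
    calc c * (16:ℝ) ^ k = c * ((2:ℝ) ^ k) ^ 4 := by
          rw [← pow_mul, mul_comm k 4, pow_mul]; norm_num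
      _ ≤ v k := hvlo k
      _ ≤ A₂ * Λ ^ k := (hΛ k).2
  have h64 : Λ ≤ 64 := by
    refine le_of_forall_mul_pow_le hA₁ (by norm_num) (B := 1) fun k => ?_
    calc A₁ * Λ ^ k ≤ v k := (hΛ k).1
      _ ≤ ((2:ℝ) ^ k) ^ 6 := hvhi k
      _ = 1 * (64:ℝ) ^ k := by
          rw [one_mul, ← pow_mul, mul_comm k 6, pow_mul]; norm_num
  -- the exponent
  set s : ℝ := 6 - Real.logb 2 Λ with hs
  have hlog16 : (4:ℝ) ≤ Real.logb 2 Λ := by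
    have h := Real.logb_le_logb_of_le one_lt_two (by norm_num) h16
    rwa [show (16:ℝ) = (2:ℝ) ^ (4:ℕ) by norm_num, logb_two_pow] at h
  have hlog64 : Real.logb 2 Λ ≤ 6 := by
    have h := Real.logb_le_logb_of_le one_lt_two hΛpos h64
    rwa [show (64:ℝ) = (2:ℝ) ^ (6:ℕ) by norm_num, logb_two_pow] at h
  have hs0 : 0 ≤ s := by simp only [hs]; linarith
  have hs2 : s ≤ 2 := by simp only [hs]; linarith
  have hΛk : ∀ k : ℕ, Λ ^ k = ((2:ℝ) ^ k) ^ ((6:ℝ) - s) := fun k => by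
    rw [show (6:ℝ) - s = Real.logb 2 Λ by simp only [hs]; ring]
    exact pow_eq_two_pow_rpow_logb hΛpos k
  -- upper envelope along `3·2^k`, then everywhere
  have hA₂ : 0 ≤ A₂ := by
    have h0 := (hvpos 0).trans_le (hΛ 0).2
    simp at h0
    exact h0.le
  have hup3 : ∀ k : ℕ, g (3 * 2 ^ k) ≤ A₂ * ((2:ℝ) ^ k) ^ (-s) := by
    intro k
    have h2k : (0:ℝ) < (2:ℝ) ^ k := by positivity
    have h6 : (0:ℝ) < ((2:ℝ) ^ k) ^ 6 := by positivity
    have h := (hvg k).trans ((hΛ k).2)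
    rw [hΛk k, show (6:ℝ) - s = 6 + (-s) by ring, Real.rpow_add h2k,
      show ((2:ℝ) ^ k) ^ (6:ℝ) = ((2:ℝ) ^ k) ^ (6:ℕ) from Real.rpow_natCast _ 6] at h
    -- `(2^k)^6 g ≤ A₂ (2^k)^6 (2^k)^{-s}`
    have h' : ((2:ℝ) ^ k) ^ 6 * g (3 * 2 ^ k) ≤ ((2:ℝ) ^ k) ^ 6 * (A₂ * ((2:ℝ) ^ k) ^ (-s)) := by
      calc ((2:ℝ) ^ k) ^ 6 * g (3 * 2 ^ k) ≤ A₂ * (((2:ℝ) ^ k) ^ 6 * ((2:ℝ) ^ k) ^ (-s)) := h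
        _ = ((2:ℝ) ^ k) ^ 6 * (A₂ * ((2:ℝ) ^ k) ^ (-s)) := by ring
    exact le_of_mul_le_mul_left h' h6
  obtain ⟨B, hB⟩ := upper_fill hgpos hganti hgle1 hs0 hup3
  -- lower envelope from the stub
  obtain ⟨c', hc', hlow⟩ := h5 s A₁ B hs0 hs2 hA₁ (fun k => by rw [← hΛk k]; exact (hΛ k).1) hB
  exact ⟨s, c', B, hc', fun n hn => ⟨hlow n hn, hB n hn⟩⟩

/-- **Two-sided axis bounds ⟹ the crux** (Messager–Miracle-Solé sphere sandwich; this is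
`CensusWeb.dimensionPinned_of_axisPinned`, re-proved because crux workfiles are not importable). -/
theorem dimensionPinned_of_axis_bounds {s c C : ℝ} (hc : 0 < c)
    (hb : ∀ n : ℕ, 1 ≤ n → c * (n : ℝ) ^ (-s) ≤ criticalTwoPoint 3 (Pi.single 0 (n : ℤ)) ∧
      criticalTwoPoint 3 (Pi.single 0 (n : ℤ)) ≤ C * (n : ℝ) ^ (-s)) :
    DimensionPinned := by
  refine ⟨s - (((3 : ℕ) : ℝ) - 2), c * (3 : ℝ) ^ (-s), C, by positivity, fun x hx => ?_⟩
  have hexp : ((3 : ℕ) : ℝ) - 2 + (s - (((3 : ℕ) : ℝ) - 2)) = s := by ring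
  rw [hexp]
  set n := Site.supNorm x with hn
  have hn1 : 1 ≤ n := Nat.one_le_iff_ne_zero.2 fun h0 => hx (Site.supNorm_eq_zero_iff.1 h0)
  have hnorm : ‖x‖ = (n : ℝ) := Site.norm_eq_supNorm x
  obtain ⟨hlo, hhi⟩ := criticalTwoPoint_axis_sandwich (y := x) hn1
  have h3n := (hb (3 * n) (by omega)).1
  have hn' := (hb n hn1).2
  rw [hnorm]
  constructor
  · calc c * (3 : ℝ) ^ (-s) * ((n : ℝ)) ^ (-s) = c * (((3 * n : ℕ) : ℝ)) ^ (-s) := by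
          rw [Nat.cast_mul, Nat.cast_ofNat, Real.mul_rpow (by norm_num) (Nat.cast_nonneg n)]
          ring
      _ ≤ criticalTwoPoint 3 (Pi.single 0 (((3 * n : ℕ)) : ℤ)) := h3n
      _ ≤ criticalTwoPoint 3 x := hlo
  · calc criticalTwoPoint 3 x ≤ criticalTwoPoint 3 (Pi.single 0 (n : ℤ)) := hhi
      _ ≤ C * (n : ℝ) ^ (-s) := hn'

end Glue

/-- **Registered stub `stub_transfer` of line `Sketch`: DCR₂₇ ⟹ the crux.** A power-rate Cauchy
property under `L ↦ 2L` of the 27 nearest normalised block covariances of the critical two-point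
function of the nearest-neighbour Ising model on `ℤ³` implies two-sided pure-power bounds
`c‖x‖^{-(1+η)} ≤ ⟨σ₀σ_x⟩_{β_c(3)} ≤ C‖x‖^{-(1+η)}` (octave telescoping on block variances, after
Li–Shiraishi's `b_n` trick for 3D loop-erased random walk, arXiv:1807.00541 §1.2). [folklore] -/
theorem stub_transfer :
    (∃ θ C : ℝ, 0 < θ ∧ ∀ L : ℕ, 1 ≤ L → ∀ u : Fin 3 → ℤ, (∀ i, |u i| ≤ 1) →
      |(∑ x ∈ Fintype.piFinset (fun _ : Fin 3 => Finset.Ico (0:ℤ) (2 * (L:ℤ))),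
          ∑ y ∈ Fintype.piFinset (fun i : Fin 3 => Finset.Ico (2 * (L:ℤ) * u i) (2 * (L:ℤ) * u i + 2 * (L:ℤ))),
            criticalTwoPoint 3 (y - x)) /
        (∑ x ∈ Fintype.piFinset (fun _ : Fin 3 => Finset.Ico (0:ℤ) (2 * (L:ℤ))),
          ∑ y ∈ Fintype.piFinset (fun _ : Fin 3 => Finset.Ico (0:ℤ) (2 * (L:ℤ))), criticalTwoPoint 3 (y - x)) -
       (∑ x ∈ Fintype.piFinset (fun _ : Fin 3 => Finset.Ico (0:ℤ) (L:ℤ)),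
          ∑ y ∈ Fintype.piFinset (fun i : Fin 3 => Finset.Ico ((L:ℤ) * u i) ((L:ℤ) * u i + (L:ℤ))),
            criticalTwoPoint 3 (y - x)) /
        (∑ x ∈ Fintype.piFinset (fun _ : Fin 3 => Finset.Ico (0:ℤ) (L:ℤ)),
          ∑ y ∈ Fintype.piFinset (fun _ : Fin 3 => Finset.Ico (0:ℤ) (L:ℤ)), criticalTwoPoint 3 (y - x))|
      ≤ C * (L : ℝ) ^ (-θ)) →
    DimensionPinned := by
  intro h1
  obtain ⟨θ, C, hθ, hrate⟩ := stub_lambdaRate h1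
  obtain ⟨c, hc, hbnd⟩ := stub_blockVarianceBounds
  -- the dyadic block variances and the axis two-point function
  let v : ℕ → ℝ := fun k =>
    ∑ x ∈ Fintype.piFinset (fun _ : Fin 3 => Finset.Ico (0:ℤ) (2 ^ k)),
      ∑ y ∈ Fintype.piFinset (fun _ : Fin 3 => Finset.Ico (0:ℤ) (2 ^ k)), criticalTwoPoint 3 (y - x)
  let g : ℕ → ℝ := fun n => criticalTwoPoint 3 (Pi.single 0 (n : ℤ))
  have hv8 : ∀ k : ℕ, 8 ≤ v (k + 1) / v k := by
    intro k
    have h := (hrate (2 ^ k) Nat.one_le_two_pow).1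
    simp only [Nat.cast_pow, Nat.cast_ofNat] at h
    rw [show (2:ℤ) * 2 ^ k = 2 ^ (k + 1) by ring] at h
    exact h
  have hvrate : ∀ k : ℕ, |v (k + 2) / v (k + 1) - v (k + 1) / v k| ≤ C * ((2:ℝ) ^ k) ^ (-θ) := by
    intro k
    have h := (hrate (2 ^ k) Nat.one_le_two_pow).2
    simp only [Nat.cast_pow, Nat.cast_ofNat] at h
    rw [show (2:ℤ) * 2 ^ k = 2 ^ (k + 1) by ring, show (4:ℤ) * 2 ^ k = 2 ^ (k + 2) by ring] at h
    exact h
  have hvlo : ∀ k : ℕ, c * ((2:ℝ) ^ k) ^ 4 ≤ v k := by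
    intro k
    have h := (hbnd (2 ^ k) Nat.one_le_two_pow).1
    simp only [Nat.cast_pow, Nat.cast_ofNat] at h
    exact h
  have hvhi : ∀ k : ℕ, v k ≤ ((2:ℝ) ^ k) ^ 6 := by
    intro k
    have h := (hbnd (2 ^ k) Nat.one_le_two_pow).2.1
    simp only [Nat.cast_pow, Nat.cast_ofNat] at h
    exact h
  have hvg : ∀ k : ℕ, ((2:ℝ) ^ k) ^ 6 * g (3 * 2 ^ k) ≤ v k := by
    intro k
    have h := (hbnd (2 ^ k) Nat.one_le_two_pow).2.2
    simp only [Nat.cast_pow, Nat.cast_ofNat] at h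
    exact h
  have hgpos : ∀ n, 0 < g n := fun n => criticalTwoPoint_axis_pos n
  have hganti : Antitone g := fun _ _ h => criticalTwoPoint_axis_antitone h
  have hgle1 : ∀ n, g n ≤ 1 := fun n => criticalTwoPoint_le_one' _
  obtain ⟨s, c', C', hc', hb⟩ := Glue.axis_bounds_core v g hθ hc hv8 hvrate hvlo hvhi hvg hgpos hganti
    hgle1 stub_octaveTelescoping stub_lowerEnvelope
  exact Glue.dimensionPinned_of_axis_bounds hc' hb

/-- The same transfer, typed as the item's home decl `ClusterRigidity.DimensionPinned` (identical term). [folklore] -/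
theorem clusterRigidity_dimensionPinned_of_dcr
    (h : ∃ θ C : ℝ, 0 < θ ∧ ∀ L : ℕ, 1 ≤ L → ∀ u : Fin 3 → ℤ, (∀ i, |u i| ≤ 1) →
      |(∑ x ∈ Fintype.piFinset (fun _ : Fin 3 => Finset.Ico (0:ℤ) (2 * (L:ℤ))),
          ∑ y ∈ Fintype.piFinset (fun i : Fin 3 => Finset.Ico (2 * (L:ℤ) * u i) (2 * (L:ℤ) * u i + 2 * (L:ℤ))),
            criticalTwoPoint 3 (y - x)) /
        (∑ x ∈ Fintype.piFinset (fun _ : Fin 3 => Finset.Ico (0:ℤ) (2 * (L:ℤ))),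
          ∑ y ∈ Fintype.piFinset (fun _ : Fin 3 => Finset.Ico (0:ℤ) (2 * (L:ℤ))), criticalTwoPoint 3 (y - x)) -
       (∑ x ∈ Fintype.piFinset (fun _ : Fin 3 => Finset.Ico (0:ℤ) (L:ℤ)),
          ∑ y ∈ Fintype.piFinset (fun i : Fin 3 => Finset.Ico ((L:ℤ) * u i) ((L:ℤ) * u i + (L:ℤ))),
            criticalTwoPoint 3 (y - x)) /
        (∑ x ∈ Fintype.piFinset (fun _ : Fin 3 => Finset.Ico (0:ℤ) (L:ℤ)),
          ∑ y ∈ Fintype.piFinset (fun _ : Fin 3 => Finset.Ico (0:ℤ) (L:ℤ)), criticalTwoPoint 3 (y - x))|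
      ≤ C * (L : ℝ) ^ (-θ)) :
    Summit.CriticalPhenomena.Ising3DConformalLimit.Theses.ClusterRigidity.DimensionPinned :=
  stub_transfer h

/-- The same transfer, typed as `HelsonAxis.EtaBoundsExist` (identical term). [folklore] -/
theorem helsonAxis_etaBoundsExist_of_dcr
    (h : ∃ θ C : ℝ, 0 < θ ∧ ∀ L : ℕ, 1 ≤ L → ∀ u : Fin 3 → ℤ, (∀ i, |u i| ≤ 1) →
      |(∑ x ∈ Fintype.piFinset (fun _ : Fin 3 => Finset.Ico (0:ℤ) (2 * (L:ℤ))),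
          ∑ y ∈ Fintype.piFinset (fun i : Fin 3 => Finset.Ico (2 * (L:ℤ) * u i) (2 * (L:ℤ) * u i + 2 * (L:ℤ))),
            criticalTwoPoint 3 (y - x)) /
        (∑ x ∈ Fintype.piFinset (fun _ : Fin 3 => Finset.Ico (0:ℤ) (2 * (L:ℤ))),
          ∑ y ∈ Fintype.piFinset (fun _ : Fin 3 => Finset.Ico (0:ℤ) (2 * (L:ℤ))), criticalTwoPoint 3 (y - x)) -
       (∑ x ∈ Fintype.piFinset (fun _ : Fin 3 => Finset.Ico (0:ℤ) (L:ℤ)),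
          ∑ y ∈ Fintype.piFinset (fun i : Fin 3 => Finset.Ico ((L:ℤ) * u i) ((L:ℤ) * u i + (L:ℤ))),
            criticalTwoPoint 3 (y - x)) /
        (∑ x ∈ Fintype.piFinset (fun _ : Fin 3 => Finset.Ico (0:ℤ) (L:ℤ)),
          ∑ y ∈ Fintype.piFinset (fun _ : Fin 3 => Finset.Ico (0:ℤ) (L:ℤ)), criticalTwoPoint 3 (y - x))|
      ≤ C * (L : ℝ) ^ (-θ)) :
    Summit.CriticalPhenomena.Ising3DConformalLimit.Theses.HelsonAxis.EtaBoundsExist :=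
  stub_transfer h

/-- **The crux is a corollary of item stmt-CriticalPhenomena-18762**: `SynchronousCoupling.DilationJoinings`
(power-rate L²-joinings of the critical Gibbs measure with its dilation by 2) implies `DimensionPinned`,
through the dock `stub_dock` (Cauchy–Schwarz) and the transfer `stub_transfer`. [folklore] -/
theorem dimensionPinned_of_dilationJoinings (h : DilationJoinings) : DimensionPinned :=
  stub_transfer (stub_dock h)

/-- The same corollary typed as the item's home decl `ClusterRigidity.DimensionPinned`. [folklore] -/
theorem clusterRigidity_dimensionPinned_of_dilationJoinings (h : DilationJoinings) :
    Summit.CriticalPhenomena.Ising3DConformalLimit.Theses.ClusterRigidity.DimensionPinned :=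
  stub_transfer (stub_dock h)

/-- The same corollary typed as `HelsonAxis.EtaBoundsExist`. [folklore] -/
theorem helsonAxis_etaBoundsExist_of_dilationJoinings (h : DilationJoinings) :
    Summit.CriticalPhenomena.Ising3DConformalLimit.Theses.HelsonAxis.EtaBoundsExist :=
  stub_transfer (stub_dock h)

end Summit.CriticalPhenomena.Ising3DConformalLimit.Theorems.CoerciveSharpnessDimensionPinned
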